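import Mathlib
import Summits.Langlands.Langlands.Theorems.PicardMuOrdinaryResidualAutomorphyEvenIntegrality
import Summits.Langlands.Langlands.Theorems.PicardMuOrdinaryResidualAutomorphyEvenPsi
import Summits.Langlands.Langlands.Theorems.PicardMuOrdinaryResidualAutomorphyEvenWeightZero

/-!
# The Teichmüller twist: killing an algebraic Hecke character modulo a prime of `ℤ̄`

Helper file for item stmt-Langlands-13760 (route `PicardMuOrdinary`, decl `ResidualAutomorphyEven`).
Let `L` be a totally complex number field, `χ` a Hecke character of `L` of infinity type `(p, q)` with
`1 + p_w, 1 + q_w ≥ 0`, `(T, e)` a module of definition of `χ` whose ideal `𝔪 = 𝔪(T, e)` is divisible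
by a rational prime `ℓ`, and `𝔐` a maximal ideal of `ℤ̄ = integralClosure ℤ ℂ` above `ℓ`.  By the
`Integrality` file the numbers `Ψ(v) = N v · χ(ϖ_v)` (`v ∉ T`) are algebraic integers and
`Ψ((b)) ≡ Ψ((c)) · (unit) (mod 𝔐)` along the ray; here we prove the **Teichmüller twist**
(`exists_teichmuller_twist`): there is a Hecke character `χ₀` of `L` of finite order, unramified off
`T`, with

  `N v · χ(ϖ_v) · χ₀(ϖ_v) ∈ ℤ̄` and `≡ 1 (mod 𝔐)` for every `v ∉ T`.

Construction: `𝔞 ↦ Ψ(𝔞) mod 𝔐` is a character of the ideals prime to `𝔪` with values in the roots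
of unity of `ℤ̄/𝔐` of some order `N₀` prime to `ℓ` (`(N v · χ(ϖ_v))^n = B(b)`, `b ≡ 1 mod 𝔪 ⊆ (ℓ)`,
so `≡ B(1) = 1`; strip the `ℓ`-part of `n` by perfectness of the Frobenius), trivial on the ray modulo
`𝔪` (`Ψ((b)) B(c) = Ψ((c)) B(b)` with `B(b) ≡ B(c) ≢ 0`); the reduction `μ_{N₀}(ℂ) → (ℤ̄/𝔐)ˣ` is a
bijection onto the `N₀`-torsion (a root of unity `≡ 1` of order prime to `ℓ` is `1`), so the inverse
character lifts to a ray class character `λ mod 𝔪` with values in `μ_{N₀}(ℂ)` (`Teichmüller lift`), and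
`χ₀` is the finite-order Hecke character of `λ` (tree: `HeckeCharacter.exists_of_isRayClassCharacter`).
-/

set_option linter.dupNamespace false -- project-wide option (lakefile weak.linter.dupNamespace); `Summit.Langlands.Langlands` is the mandated namespace

noncomputable section

namespace Summit.Langlands.Langlands.Theorems.ResidualAutomorphyEven

open NumberField NumberField.InfinitePlace IsDedekindDomain Filter
open Literature.NumberTheory.GaloisRepresentations Literature.NumberTheory.LFunctions
open scoped ComplexConjugate Classical

/-! ### `ℤ̄ = integralClosure ℤ ℂ`: the integral lift `zlift` -/

/-- `zlift` of a product of algebraic integers. -/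
theorem zlift_mul {a b : ℂ} (ha : IsIntegral ℤ a) (hb : IsIntegral ℤ b) : zlift (a * b) = zlift a * zlift b := by
  apply Subtype.val_injective
  change algebraMap (integralClosure ℤ ℂ) ℂ (zlift (a * b)) = algebraMap (integralClosure ℤ ℂ) ℂ (zlift a * zlift b)
  rw [map_mul, algebraMap_zlift ha, algebraMap_zlift hb, algebraMap_zlift (ha.mul hb)]

/-- `zlift` of a power of an algebraic integer. -/
theorem zlift_pow {a : ℂ} (ha : IsIntegral ℤ a) (n : ℕ) : zlift (a ^ n) = zlift a ^ n := by
  apply Subtype.val_injective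
  change algebraMap (integralClosure ℤ ℂ) ℂ (zlift (a ^ n)) = algebraMap (integralClosure ℤ ℂ) ℂ (zlift a ^ n)
  rw [map_pow, algebraMap_zlift ha, algebraMap_zlift (ha.pow n)]

/-- `zlift 1 = 1`. -/
theorem zlift_one : zlift (1 : ℂ) = 1 := by
  apply Subtype.val_injective
  change algebraMap (integralClosure ℤ ℂ) ℂ (zlift 1) = algebraMap (integralClosure ℤ ℂ) ℂ 1
  rw [map_one, algebraMap_zlift isIntegral_one]

/-- `zlift` is injective on algebraic integers. -/
theorem zlift_inj {a b : ℂ} (ha : IsIntegral ℤ a) (hb : IsIntegral ℤ b) (h : zlift a = zlift b) : a = b := by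
  rw [← algebraMap_zlift ha, ← algebraMap_zlift hb, h]

/-- A natural number that lies in a proper ideal `𝔐 ∋ ℓ` of `ℤ̄` (`ℓ` prime) is divisible by `ℓ`. -/
theorem dvd_of_natCast_mem {𝔐 : Ideal (integralClosure ℤ ℂ)} (h𝔐 : 𝔐 ≠ ⊤) {ℓ : ℕ} (hℓ : ℓ.Prime)
    (hℓ𝔐 : (ℓ : integralClosure ℤ ℂ) ∈ 𝔐) {n : ℕ} (hn : (n : integralClosure ℤ ℂ) ∈ 𝔐) : ℓ ∣ n := by
  by_contra hnd
  have hcop : Nat.Coprime ℓ n := (Nat.Prime.coprime_iff_not_dvd hℓ).mpr hnd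
  have h := (Nat.isCoprime_iff_coprime.mpr hcop).map (Int.castRingHom (integralClosure ℤ ℂ))
  simp only [map_natCast] at h
  obtain ⟨a, b, hab⟩ := h
  exact h𝔐 ((Ideal.eq_top_iff_one _).mpr (hab ▸ 𝔐.add_mem (𝔐.mul_mem_left a hℓ𝔐) (𝔐.mul_mem_left b hn)))

/-! ### Roots of unity of order prime to `ℓ` reduce injectively modulo `𝔐` -/

section Teichmuller

variable {𝔐 : Ideal (integralClosure ℤ ℂ)} [h𝔐 : 𝔐.IsMaximal] {ℓ : ℕ}

/-- **Reduction modulo `𝔐 ∋ ℓ` is injective on the roots of unity of order `N` prime to `ℓ`.** -/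
theorem eq_of_pow_eq_one_of_zlift_eq (hℓ : ℓ.Prime) (hℓ𝔐 : (ℓ : integralClosure ℤ ℂ) ∈ 𝔐) {N : ℕ}
    (hN : ¬ ℓ ∣ N) {a b : ℂ} (ha : a ^ N = 1) (hb : b ^ N = 1)
    (h : Ideal.Quotient.mk 𝔐 (zlift a) = Ideal.Quotient.mk 𝔐 (zlift b)) : a = b := by
  have hNpos : 0 < N := Nat.pos_of_ne_zero fun h0 => hN (h0 ▸ dvd_zero ℓ)
  have hb0 : b ≠ 0 := fun h0 => by rw [h0, zero_pow hNpos.ne'] at hb; exact zero_ne_one hb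
  have hai : IsIntegral ℤ a := IsIntegral.of_pow hNpos (by rw [ha]; exact isIntegral_one)
  have hbi : IsIntegral ℤ b := IsIntegral.of_pow hNpos (by rw [hb]; exact isIntegral_one)
  -- `ζ = a b⁻¹ = a b^{N-1}` is an `N`-th root of unity `≡ 1 (mod 𝔐)`
  have hbinv : b⁻¹ = b ^ (N - 1) :=
    inv_eq_of_mul_eq_one_right (by rw [← pow_succ', Nat.sub_add_cancel hNpos, hb])
  set ζ : ℂ := a * b ^ (N - 1) with hζ
  have hζi : IsIntegral ℤ ζ := hai.mul (hbi.pow _)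
  have hζN : ζ ^ N = 1 := by rw [hζ, mul_pow, ← pow_mul, mul_comm (N - 1) N, pow_mul, hb, one_pow, mul_one, ha]
  have hζ1 : zlift ζ - 1 ∈ 𝔐 := by
    rw [← Ideal.Quotient.eq, map_one, hζ, zlift_mul hai (hbi.pow _), map_mul, h, ← map_mul, ← zlift_mul hbi (hbi.pow _),
      ← pow_succ', Nat.sub_add_cancel hNpos, zlift_pow hbi]
    have : zlift b ^ N = 1 := by rw [← zlift_pow hbi, hb, zlift_one]
    rw [this, map_one]
  have hζN' : zlift ζ ^ N = 1 := by rw [← zlift_pow hζi, hζN, zlift_one]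
  haveI := h𝔐.isPrime
  have hNmem : (N : integralClosure ℤ ℂ) ∉ 𝔐 := fun hmem => hN (dvd_of_natCast_mem h𝔐.ne_top hℓ hℓ𝔐 hmem)
  have hζone : zlift ζ = 1 := eq_one_of_pow_eq_one_of_sub_one_mem hζN' 𝔐 hζ1 hNmem
  have hζone' : ζ = 1 := by rw [← algebraMap_zlift hζi, hζone, map_one]
  -- so `a = b`
  have : a * b⁻¹ = 1 := by rw [hbinv]; exact hζone'
  rwa [mul_inv_eq_one₀ hb0] at this

/-- **Teichmüller lift.** For `𝔐 ∋ ℓ` maximal and `N` prime to `ℓ`, every `N`-torsion element of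
`(ℤ̄/𝔐)ˣ` is the reduction of a unique `N`-th root of unity of `ℂ`; we record the existence of a lift
function `τ` on `F = ℤ̄/𝔐` with `τ(x)^N = 1` and `τ(x) ≡ x` whenever `x^N = 1`. -/
theorem exists_teichmuller (hℓ : ℓ.Prime) (hℓ𝔐 : (ℓ : integralClosure ℤ ℂ) ∈ 𝔐) {N : ℕ} (hN : ¬ ℓ ∣ N) :
    ∃ τ : integralClosure ℤ ℂ ⧸ 𝔐 → ℂ, ∀ x : integralClosure ℤ ℂ ⧸ 𝔐, x ^ N = 1 →
      τ x ^ N = 1 ∧ Ideal.Quotient.mk 𝔐 (zlift (τ x)) = x := by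
  have hNpos : 0 < N := Nat.pos_of_ne_zero fun h0 => hN (h0 ▸ dvd_zero ℓ)
  haveI : NeZero N := ⟨hNpos.ne'⟩
  letI : Field (integralClosure ℤ ℂ ⧸ 𝔐) := Ideal.Quotient.field 𝔐
  -- a primitive `N`-th root of unity and the reductions of its powers
  set ζ₀ : ℂ := Complex.exp (2 * Real.pi * Complex.I / N) with hζ₀
  have hprim : IsPrimitiveRoot ζ₀ N := Complex.isPrimitiveRoot_exp N hNpos.ne'
  have hζi : IsIntegral ℤ ζ₀ := IsIntegral.of_pow hNpos (by rw [hprim.pow_eq_one]; exact isIntegral_one)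
  set r : ℕ → integralClosure ℤ ℂ ⧸ 𝔐 := fun j => Ideal.Quotient.mk 𝔐 (zlift (ζ₀ ^ j)) with hr
  have hrpow : ∀ j, r j ^ N = 1 := fun j => by
    simp only [hr]
    rw [← map_pow, ← zlift_pow (hζi.pow j), ← pow_mul, mul_comm, pow_mul, hprim.pow_eq_one, one_pow, zlift_one, map_one]
  -- `r` is injective on `[0, N)`
  have hrinj : Set.InjOn r (Finset.range N : Set ℕ) := by
    intro i hi j hj hij
    have hi' : i < N := Finset.mem_range.mp hi
    have hj' : j < N := Finset.mem_range.mp hj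
    have hpi : (ζ₀ ^ i) ^ N = 1 := by rw [← pow_mul, mul_comm, pow_mul, hprim.pow_eq_one, one_pow]
    have hpj : (ζ₀ ^ j) ^ N = 1 := by rw [← pow_mul, mul_comm, pow_mul, hprim.pow_eq_one, one_pow]
    have heq : ζ₀ ^ i = ζ₀ ^ j := eq_of_pow_eq_one_of_zlift_eq hℓ hℓ𝔐 hN hpi hpj hij
    exact hprim.pow_inj hi' hj' heq
  -- the `N`-torsion of `F` has at most `N` elements, so it is the image of `r`
  have himage : ∀ x : integralClosure ℤ ℂ ⧸ 𝔐, x ^ N = 1 → x ∈ (Finset.range N).image r := by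
    intro x hx
    set S := (Polynomial.nthRoots N (1 : integralClosure ℤ ℂ ⧸ 𝔐)).toFinset with hS
    have hsub : (Finset.range N).image r ⊆ S := by
      intro y hy
      obtain ⟨j, -, rfl⟩ := Finset.mem_image.mp hy
      rw [hS, Multiset.mem_toFinset, Polynomial.mem_nthRoots hNpos]
      exact hrpow j
    have hcard : S.card ≤ ((Finset.range N).image r).card := by
      rw [Finset.card_image_of_injOn hrinj, Finset.card_range]
      exact (Multiset.toFinset_card_le _).trans (Polynomial.card_nthRoots N 1)
    have hSeq : (Finset.range N).image r = S := Finset.eq_of_subset_of_card_le hsub hcard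
    rw [hSeq, hS, Multiset.mem_toFinset, Polynomial.mem_nthRoots hNpos]
    exact hx
  refine ⟨fun x => if h : ∃ j, r j = x then ζ₀ ^ Classical.choose h else 1, fun x hx => ?_⟩
  have hex : ∃ j, r j = x := by
    obtain ⟨j, -, hj⟩ := Finset.mem_image.mp (himage x hx)
    exact ⟨j, hj⟩
  simp only [dif_pos hex]
  refine ⟨by rw [← pow_mul, mul_comm, pow_mul, hprim.pow_eq_one, one_pow], ?_⟩
  exact Classical.choose_spec hex

/-- **Uniqueness of the Teichmüller lift**: an `N`-th root of unity is determined by its reduction. -/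
theorem teichmuller_unique (hℓ : ℓ.Prime) (hℓ𝔐 : (ℓ : integralClosure ℤ ℂ) ∈ 𝔐) {N : ℕ} (hN : ¬ ℓ ∣ N)
    {τ : integralClosure ℤ ℂ ⧸ 𝔐 → ℂ}
    (hτ : ∀ x : integralClosure ℤ ℂ ⧸ 𝔐, x ^ N = 1 → τ x ^ N = 1 ∧ Ideal.Quotient.mk 𝔐 (zlift (τ x)) = x)
    {x : integralClosure ℤ ℂ ⧸ 𝔐} (hx : x ^ N = 1) {a : ℂ} (ha : a ^ N = 1)
    (hax : Ideal.Quotient.mk 𝔐 (zlift a) = x) : a = τ x :=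
  eq_of_pow_eq_one_of_zlift_eq hℓ hℓ𝔐 hN ha (hτ x hx).1 (hax.trans (hτ x hx).2.symm)

/-- **The Teichmüller lift is multiplicative** on the `N`-torsion. -/
theorem teichmuller_mul (hℓ : ℓ.Prime) (hℓ𝔐 : (ℓ : integralClosure ℤ ℂ) ∈ 𝔐) {N : ℕ} (hN : ¬ ℓ ∣ N)
    {τ : integralClosure ℤ ℂ ⧸ 𝔐 → ℂ}
    (hτ : ∀ x : integralClosure ℤ ℂ ⧸ 𝔐, x ^ N = 1 → τ x ^ N = 1 ∧ Ideal.Quotient.mk 𝔐 (zlift (τ x)) = x)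
    {x y : integralClosure ℤ ℂ ⧸ 𝔐} (hx : x ^ N = 1) (hy : y ^ N = 1) : τ (x * y) = τ x * τ y := by
  have hNpos : 0 < N := Nat.pos_of_ne_zero fun h0 => hN (h0 ▸ dvd_zero ℓ)
  have hxy : (x * y) ^ N = 1 := by rw [mul_pow, hx, hy, one_mul]
  have hxi : IsIntegral ℤ (τ x) := IsIntegral.of_pow hNpos (by rw [(hτ x hx).1]; exact isIntegral_one)
  have hyi : IsIntegral ℤ (τ y) := IsIntegral.of_pow hNpos (by rw [(hτ y hy).1]; exact isIntegral_one)
  symm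
  refine teichmuller_unique hℓ hℓ𝔐 hN hτ hxy ?_ ?_
  · rw [mul_pow, (hτ x hx).1, (hτ y hy).1, one_mul]
  · rw [zlift_mul hxi hyi, map_mul, (hτ x hx).2, (hτ y hy).2]

/-- `τ 1 = 1`. -/
theorem teichmuller_one (hℓ : ℓ.Prime) (hℓ𝔐 : (ℓ : integralClosure ℤ ℂ) ∈ 𝔐) {N : ℕ} (hN : ¬ ℓ ∣ N)
    {τ : integralClosure ℤ ℂ ⧸ 𝔐 → ℂ}
    (hτ : ∀ x : integralClosure ℤ ℂ ⧸ 𝔐, x ^ N = 1 → τ x ^ N = 1 ∧ Ideal.Quotient.mk 𝔐 (zlift (τ x)) = x) :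
    τ 1 = 1 :=
  (teichmuller_unique hℓ hℓ𝔐 hN hτ (one_pow N) (one_pow N) (by rw [zlift_one, map_one])).symm

omit h𝔐 in
/-- `|τ x| = 1` on the `N`-torsion (a root of unity). -/
theorem norm_teichmuller {N : ℕ} (hN : 0 < N) {τ : integralClosure ℤ ℂ ⧸ 𝔐 → ℂ}
    {x : integralClosure ℤ ℂ ⧸ 𝔐} (h : τ x ^ N = 1) : ‖τ x‖ = 1 := by
  have := congrArg norm h
  rw [norm_pow, norm_one] at this
  exact (pow_eq_one_iff_of_nonneg (norm_nonneg _) hN.ne').mp this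

/-- In the field `ℤ̄/𝔐` of characteristic `ℓ`, `x^{ℓ^k m} = 1` forces `x^m = 1` (perfectness of the
Frobenius). -/
theorem pow_eq_one_of_pow_prime_pow_mul (hℓ : ℓ.Prime) (hℓ𝔐 : (ℓ : integralClosure ℤ ℂ) ∈ 𝔐) {k m : ℕ}
    {x : integralClosure ℤ ℂ ⧸ 𝔐} (hx : x ^ (ℓ ^ k * m) = 1) : x ^ m = 1 := by
  letI : Field (integralClosure ℤ ℂ ⧸ 𝔐) := Ideal.Quotient.field 𝔐
  have h0 : (ℓ : integralClosure ℤ ℂ ⧸ 𝔐) = 0 := by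
    rw [← map_natCast (Ideal.Quotient.mk 𝔐), Ideal.Quotient.eq_zero_iff_mem]
    exact hℓ𝔐
  haveI : CharP (integralClosure ℤ ℂ ⧸ 𝔐) ℓ := (CharP.charP_iff_prime_eq_zero hℓ).mpr h0
  haveI : ExpChar (integralClosure ℤ ℂ ⧸ 𝔐) ℓ := ExpChar.prime hℓ
  exact (ExpChar.pow_prime_pow_mul_eq_one_iff ℓ k m x).mp hx

end Teichmuller

/-! ### More `zlift` algebra -/

/-- `zlift` of a difference of algebraic integers. -/
theorem zlift_sub {a b : ℂ} (ha : IsIntegral ℤ a) (hb : IsIntegral ℤ b) : zlift (a - b) = zlift a - zlift b := by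
  apply Subtype.val_injective
  change algebraMap (integralClosure ℤ ℂ) ℂ (zlift (a - b)) = algebraMap (integralClosure ℤ ℂ) ℂ (zlift a - zlift b)
  rw [map_sub, algebraMap_zlift ha, algebraMap_zlift hb, algebraMap_zlift (ha.sub hb)]

/-- `zlift` of a natural number. -/
theorem zlift_natCast (n : ℕ) : zlift (n : ℂ) = n := by
  apply Subtype.val_injective
  change algebraMap (integralClosure ℤ ℂ) ℂ (zlift n) = algebraMap (integralClosure ℤ ℂ) ℂ n
  rw [map_natCast, algebraMap_zlift (isIntegral_natCast _)]

/-- `zlift` of a finite product of algebraic integers. -/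
theorem zlift_prod {ι : Type*} (s : Finset ι) {f : ι → ℂ} (hf : ∀ i ∈ s, IsIntegral ℤ (f i)) :
    zlift (∏ i ∈ s, f i) = ∏ i ∈ s, zlift (f i) := by
  induction s using Finset.induction_on with
  | empty => rw [Finset.prod_empty, Finset.prod_empty, zlift_one]
  | insert a s has ih =>
    rw [Finset.prod_insert has, Finset.prod_insert has,
      zlift_mul (hf a (Finset.mem_insert_self a s)) (IsIntegral.prod _ fun i hi => hf i (Finset.mem_insert_of_mem hi)),
      ih fun i hi => hf i (Finset.mem_insert_of_mem hi)]

/-! ### Embeddings of `𝓞_L` modulo `𝔐`: congruences and non-vanishing -/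

section Embeddings

variable {L : Type*} [Field L] [NumberField L] {𝔐 : Ideal (integralClosure ℤ ℂ)} {ℓ : ℕ}

omit [NumberField L] in
/-- `σ(x)` is an algebraic integer for `x ∈ 𝓞_L`. -/
theorem isIntegral_apply_coe (φ : L →+* ℂ) (x : 𝓞 L) : IsIntegral ℤ (φ (x : L)) :=
  (RingOfIntegers.isIntegral_coe x).map φ.toIntAlgHom

/-- **`x ≡ y (mod ℓ)` in `𝓞_L` gives `σ(x) ≡ σ(y) (mod 𝔐)`** for `𝔐 ∋ ℓ`. -/
theorem mk_zlift_apply_eq (hℓ𝔐 : (ℓ : integralClosure ℤ ℂ) ∈ 𝔐) (φ : L →+* ℂ) {x y : 𝓞 L}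
    (h : x - y ∈ Ideal.span {(ℓ : 𝓞 L)}) :
    Ideal.Quotient.mk 𝔐 (zlift (φ (x : L))) = Ideal.Quotient.mk 𝔐 (zlift (φ (y : L))) := by
  obtain ⟨z, hz⟩ := Ideal.mem_span_singleton'.mp h
  rw [Ideal.Quotient.eq, ← zlift_sub (isIntegral_apply_coe φ x) (isIntegral_apply_coe φ y), ← map_sub]
  have hxy : ((x - y : 𝓞 L) : L) = (z : L) * ℓ := by rw [← hz]; push_cast; ring
  rw [show (x : L) - y = ((x - y : 𝓞 L) : L) by push_cast; ring, hxy, map_mul, map_natCast,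
    zlift_mul (isIntegral_apply_coe φ z) (isIntegral_natCast _), zlift_natCast]
  exact 𝔐.mul_mem_left _ hℓ𝔐

/-- **`σ(c) ∉ 𝔐` for `c` prime to `ℓ`** (`r c + s ℓ = 1` gives `σ(r) σ(c) + σ(s) ℓ = 1`). -/
theorem mk_zlift_apply_ne_zero [𝔐.IsPrime] (hℓ𝔐 : (ℓ : integralClosure ℤ ℂ) ∈ 𝔐) (φ : L →+* ℂ) {c : 𝓞 L}
    (hc : IsCoprime (Ideal.span {c}) (Ideal.span {(ℓ : 𝓞 L)})) :
    Ideal.Quotient.mk 𝔐 (zlift (φ (c : L))) ≠ 0 := by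
  intro h0
  rw [Ideal.Quotient.eq_zero_iff_mem] at h0
  obtain ⟨u, hu, t, ht, hut⟩ := Ideal.isCoprime_iff_exists.mp hc
  obtain ⟨r, rfl⟩ := Ideal.mem_span_singleton'.mp hu
  obtain ⟨s, rfl⟩ := Ideal.mem_span_singleton'.mp ht
  have h1 : zlift (φ (r : L)) * zlift (φ (c : L)) + zlift (φ (s : L)) * ℓ = 1 := by
    apply Subtype.val_injective
    have e : ∀ x : 𝓞 L, ((zlift (φ (x : L)) : integralClosure ℤ ℂ) : ℂ) = φ (x : L) := fun x =>
      algebraMap_zlift (isIntegral_apply_coe φ x)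
    push_cast
    rw [e, e, e]
    have key : φ (((r * c + s * ℓ : 𝓞 L)) : L) = 1 := by rw [hut]; simp
    have key' : φ (((r * c + s * ℓ : 𝓞 L)) : L) = φ (r : L) * φ (c : L) + φ (s : L) * (ℓ : ℂ) := by
      push_cast
      rw [map_add, map_mul, map_mul, map_natCast]
    rw [← key', key]
  have hmem : (1 : integralClosure ℤ ℂ) ∈ 𝔐 := by
    rw [← h1]
    exact 𝔐.add_mem (𝔐.mul_mem_left _ h0) (𝔐.mul_mem_left _ hℓ𝔐)
  exact Ideal.IsPrime.ne_top ‹_› ((Ideal.eq_top_iff_one _).mpr hmem)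

/-- `embProd a b x` is integral on `𝓞_L` with `zlift (B(x)) = ∏_w zlift(σ_w x)^{a_w} zlift(\overline{σ_w} x)^{b_w}`. -/
theorem zlift_embProd (a b : InfinitePlace L → ℕ) (x : 𝓞 L) :
    zlift (embProd a b (x : L)) =
      ∏ w : InfinitePlace L, zlift (w.embedding (x : L)) ^ a w *
        zlift (ComplexEmbedding.conjugate w.embedding (x : L)) ^ b w := by
  rw [embProd, zlift_prod]
  · refine Finset.prod_congr rfl fun w _ => ?_
    rw [← ComplexEmbedding.conjugate_coe_eq, zlift_mul ((isIntegral_apply_coe _ x).pow _) ((isIntegral_apply_coe _ x).pow _),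
      zlift_pow (isIntegral_apply_coe _ x), zlift_pow (isIntegral_apply_coe _ x)]
  · intro w _
    rw [← ComplexEmbedding.conjugate_coe_eq]
    exact ((isIntegral_apply_coe _ x).pow _).mul ((isIntegral_apply_coe _ x).pow _)

/-- **`B(x) ≡ B(y) (mod 𝔐)` for `x ≡ y (mod ℓ)`.** -/
theorem mk_zlift_embProd_eq (hℓ𝔐 : (ℓ : integralClosure ℤ ℂ) ∈ 𝔐) (a b : InfinitePlace L → ℕ) {x y : 𝓞 L}
    (h : x - y ∈ Ideal.span {(ℓ : 𝓞 L)}) :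
    Ideal.Quotient.mk 𝔐 (zlift (embProd a b (x : L))) = Ideal.Quotient.mk 𝔐 (zlift (embProd a b (y : L))) := by
  rw [zlift_embProd, zlift_embProd, map_prod, map_prod]
  refine Finset.prod_congr rfl fun w _ => ?_
  rw [map_mul, map_mul, map_pow, map_pow, map_pow, map_pow, mk_zlift_apply_eq hℓ𝔐 _ h,
    mk_zlift_apply_eq hℓ𝔐 (ComplexEmbedding.conjugate w.embedding) h]

/-- **`B(c) ≢ 0 (mod 𝔐)` for `c` prime to `ℓ`.** -/
theorem mk_zlift_embProd_ne_zero [𝔐.IsPrime] (hℓ𝔐 : (ℓ : integralClosure ℤ ℂ) ∈ 𝔐) (a b : InfinitePlace L → ℕ)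
    {c : 𝓞 L} (hc : IsCoprime (Ideal.span {c}) (Ideal.span {(ℓ : 𝓞 L)})) :
    Ideal.Quotient.mk 𝔐 (zlift (embProd a b (c : L))) ≠ 0 := by
  haveI : IsDomain (integralClosure ℤ ℂ ⧸ 𝔐) := Ideal.Quotient.isDomain 𝔐
  rw [zlift_embProd, map_prod]
  refine Finset.prod_ne_zero_iff.mpr fun w _ => ?_
  rw [map_mul, map_pow, map_pow]
  exact mul_ne_zero (pow_ne_zero _ (mk_zlift_apply_ne_zero hℓ𝔐 _ hc))
    (pow_ne_zero _ (mk_zlift_apply_ne_zero hℓ𝔐 (ComplexEmbedding.conjugate w.embedding) hc))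

end Embeddings

end Summit.Langlands.Langlands.Theorems.ResidualAutomorphyEven
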